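import Mathlib
import Literature.MathematicalPhysics.QuantumFieldTheory.Balaban1983to89.B6CoverTorus
import Literature.MathematicalPhysics.QuantumFieldTheory.Balaban1983to89.B6QGQCoerciveTowerTorus
import Literature.MathematicalPhysics.QuantumFieldTheory.Balaban1983to89.B6Ineq268OneScaleTorus

/-!
# `Balaban1983to89.B6Expansion286TowerTorus` — T. Bałaban, *Propagators and renormalization transformations for lattice gauge theories. II*,
Commun. Math. Phys. **96** (1984) 223–250 [Balaban1984PropagatorsII]: **Proposition 2.3's random-walk construction (2.70), (2.82), (2.85),
(2.86), (2.87) RUN END TO END FOR THE GENUINE ONE-SCALE OPERATOR `Q′_KG′_K²Q′_K*`** on the tower-torus family of `…B6Prop22OneScaleTorus`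
(`G′_K = Δ′_a⁻¹ = (−Δ^η + m² + a_KQ′_K*Q′_K)⁻¹` of `B1RG242Torus.tower`), with the print's ONE-SCALE PRESCRIPTION `C_□ = ((Q′G′²Q′*)↾□)⁻¹`

statement-level skeleton of published theorems with citation tags; proofs where landed; nothing here is a claim about the Yang–Mills mass gap

Phase-2 PROOF SEAT p01 (gen 7) of the cell `lit-balaban` (HOME `run/shared/lean/pub/lit-balaban/`), free-target protocol G.5-34(d), own lane; rows
B6.Prop2.3 / B6.Eq2.85 / B6.Eq2.82 / B6.Eq2.70 of `HOME/lit-balaban-r03/ROWS-B6.md` (owner r03, referee ref-4) — GENUINE MODEL INSTANCE.  Sources read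
as page images: `run/shared/lean/pub/pub-balaban/b2b-balaban-ref1/pages/1984-cmp96-propagators-rt-II/1984-cmp96-propagators-rt-II-p013-x2.png` (p. 235),
`…-p015-x2.png` (p. 237), `…-p016-x2.png` (p. 238); journal page = PDF page + 222.

THE PRINTED TEXT.  p. 235 [PDF 13]: *"Now we will consider the operator (Q′G′²Q′*)⁻¹. Of course the operator Q′G′²Q′* is positive definite, so its
inverse is well defined. We will construct it and investigate its properties using again a random walk expansion. Our considerations are analogous to
Sect. 5 of [3], concerning unit lattice operators. If we have one scale, i.e. Λ_k = T₁^{(k)}, then the operator is a unit lattice operator. The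
inverse operator is constructed by taking an approximate inverse and then solving an exact equation. The approximate inverse can be constructed by
taking inverses of the localized operators (Q′G′²Q′*)↾□ and glueing them together by the decomposition of unity {h_□}. We change this prescription
a little bit; we take a second cube □̃ containing □ in the middle and of the size 4M and we take an inverse of the operator (Q′G′(□̃)²Q′*)↾□ instead
of (Q′G′²Q′*)↾□. Let us define C_□ = ((Q′G′(□̃)²Q′*)↾□)⁻¹, C = Σ_{□∈𝒟} h_□C_□h_□. (2.70)"*  p. 237 [PDF 15]: *"|C_□(y, y′)| ≤ O(1)(L^jη)^{−d−4}
e^{−δ₁(L^jη)^{−1}|y−y′|}, y, y′ ∈ 𝔅∩□. (2.81) Now we will proceed in the same way as in Sect. 5, (5.12)–(5.17) [3]. We will show that Q′G′²Q′*C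
is a good approximation of identity. We have Q′G′²Q′*C = … = I − Σ_{□,□′} R_{□,□′}C_{□′}h_{□′} = I − R, (2.82)"*  p. 238 [PDF 16]: *"It can be
written as |R(y, y′)| ≤ O(M⁻¹)e^{−δ₁d(y,y′)}(L^{j′}η)^{−d}, y, y′ ∈ 𝔅, y′ ∈ Λ_{j′}, (2.85) and by Lemma 2.1 we get Proposition 2.3. An inverse of
the operator Q′G′²Q′* is given by the convergent expansion (Q′G′²Q′*)⁻¹ = C(I − R)⁻¹ = Σ_{n=0}^∞ CRⁿ = Σ_ω h_{□₀}C_{□₀}h_{□₀}R_{□₁,□₂}C_{□₂}h_{□₂}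
·…· (2.86) and it satisfies the estimate |(Q′G′²Q′*)⁻¹(y, y′)| ≤ O(1)(L^jη)^{−4}(L^{j′}η)^{−d}e^{−½δ₁d(y,y′)} (2.87)"*.

WHAT THIS FILE PROVES (kernel-checked, 0 sorry, axioms standard), for the GENUINE `X = Q′_KG′_K²Q′_K*` (`B6QGGQInvTowerTorus.qggqK`) on
`T₁^{(K)} = Site P K` and the torus cover `B6CoverTorus` (cube size `M = i.Mb`, the member's big-block size):
* §1 `Acomp` = `(Q′G′²Q′*)↾□` (compression to the 2M-cube □), `Cloc` = `C_□ = ((Q′G′²Q′*)↾□)⁻¹` extended by 0, and **(2.70) as the inverse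
  identity** `Σ_{z∈□}X(y,z)C_□(z,y″) = δ_{y,y″}` on □ (`sum_cubeInd_qggqK_Cloc`; the compression of the coercive `X` is invertible).
* §2 the objects of (2.70)/(2.82) as matrices (`Pmat`, `Hmat`, `Cmat`, `Capp` = `C`, `Rrw` = `R` — the cell's verbatim ring expressions
  `B6Expansion282.Cglued`/`R282` evaluated in the matrix ring, with `X̃_□ := X`): **(2.82) `X·C = I − R`** (`expansion282_towerTorus`) and
  **(2.86) in fixed-point form `X⁻¹ = C + X⁻¹R`** (`inv_eq_Capp_add`, `inv_eq_sum_add`) for EVERY member and every admissible cube size — the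
  three hypotheses of the cell's algebra (□h_□ = h_□, (2.36), (2.70)) DISCHARGED on the genuine objects.
* §3 **(2.81) for the genuine `C_□`, uniformly** (`ineq281_towerTorus`): [3] Sect. 5 (5.6) ⇒ (5.7) for the COMPRESSION (`B4Sect5Torus.inv_submatrix_decay`)
  fed with the uniform coercivity `Q′G′²Q′* ≥ 1/C_q²` (`B6QGQCoerciveTowerTorus.coercive_qgq_family`, `coercive_qggqK_of_qgqK`) and (2.68)
  (`B6Ineq268OneScaleTorus.ineq268_oneScaleTorus`).
* §4 dictionary: the matrices ARE the census operators on `L²(𝔅)` (`B6Expansion282.mulOp`/`kerOp`, weights `(L^jη)^d = 1`) under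
  `Matrix.toLinAlgEquiv'`.  §5 the Neumann series in the `ℓ^∞ → ℓ^∞` norm (`hasSum_neumann`).
* §6 **`expansion286_towerTorus`** — for `d ≥ 1`, odd `L > 1`, `a > 0`, `m² ≥ 0` there are `M₀, δ₁, K, B > 0` such that every member with
  `R ≥ 1`, `M ≥ M₀`, `M ∣ N_K`, `2M ≤ N_K` satisfies **(2.85)** `|R(y,y′)| ≤ (K/M)e^{−δ₁|y−y′|₁}`, row sums of `|R|` ≤ ½, **(2.86)**
  `HasSum (n ↦ CRⁿ) (Q′G′²Q′*)⁻¹` (the series CONVERGES to the genuine inverse; truncation error `≤ B·2^{−N}`; entrywise `hasSum_entry_of_hasSum`)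
  and **(2.87)** `|(Q′G′²Q′*)⁻¹(y,y′)| ≤ Be^{−½δ₁|y−y′|₁}`; obtained by DISCHARGING ALL 26 located inputs of the cell's certificate
  `B6Prop23Assembled.prop23_assembled` / `mat_R_abs_le` ((2.82)–(2.87) with every O(·) explicit) on the genuine objects; `members_exist` (non-vacuity:
  `M = L^{m′} ≥ M₀`, `m = m′ + 1`, `R = 1`).

HONEST SCOPE ∕ NOT CLAIMED.  (a) ONE SCALE (`Λ_K = T₁^{(K)}`, the print's own one-scale case; `(L^jη)^{±…} = 1`): the multi-scale Proposition 2.3 and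
the change-of-domain family of (2.82) are not touched — with the print's UNMODIFIED one-scale prescription `X̃_□ = X` that family is void (`B_D = 0`);
the MODIFIED prescription `(Q′G′(□̃)²Q′*)↾□` of (2.70) (needed across levels) is NOT used here.  (b) The thresholds `R ≥ 1`, `M ≥ M₀` (incl.
`L⁴ ≤ e^{⅛δ₀RM}`) are those of the census certificate (the off-diagonal family uses (2.60)/(2.83) member 4 ⇒ 5); on one scale `R` has no geometric
meaning ((2.1)–(2.2) are vacuous, `Hyp21_22 := True` in `oneScaleGeo`).  (c) (2.87) was already inhabited threshold-free on this family by the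
Combes–Thomas route (`B6QGQCoerciveTowerTorus.prop23Printed_towerTorus`); the value here is the PRINTED ROUTE — local inverses, glueing, (2.82),
(2.85), the convergent expansion (2.86) — for the genuine operator.  (d) The path form `Σ_ω` of (2.86) is the expansion of the products in `Σ_n CRⁿ`
(`B6Expansion282.R282_eq_pairSum`), not restated.  (e) Cover: Lipschitz profile, corner-anchored cubes (see `B6CoverTorus`).  Scalar model, torus sizes of
the tower, constants existential (functions of `d, L, a, m²`).  Value = kernel certificate that the printed construction of Proposition 2.3 runs on a
genuine renormalization-group operator; NOT summit progress.
-/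

namespace Literature.MathematicalPhysics.QuantumFieldTheory.Balaban1983to89.B6Expansion286TowerTorus

open Finset Matrix
open B4Sect5Torus (Hyp56 IsPseudoDist SumBound rate rate_pos inv_submatrix_decay hyp56_submatrix isUnit_of_hyp56
  sum_eq_sum_range)
open B1RG242Torus (tower Qk Qks)
open QGQInverse (Coercive)
open B6Prop22OneScaleTorus (T1 oneScaleGeo Index oneScaleGeo_len)
open B6Lemma21TowerTorus (T1_triangle T1_symm T1_nonneg triangle254_oneScaleGeo sum_exp_T1_le)
open B6QGGQInvTowerTorus (qggqK qggqK_transpose coercive_qggqK_of_qgqK T1_isPseudoDist T1_sumBound hyp56_qggqK T1_self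
  qggqK_isUnit mul_cinvK cinvK_mul)
open B6QGQCoerciveTowerTorus (coercive_qgq_family Cq Cq_pos)
open B6Ineq268OneScaleTorus (ineq268_oneScaleTorus)
open B6Expansion282 (mulOp kerOp locOp Cglued R282 Rpair comm PartitionSq expansion282 inverse_fixedPoint
  neumann_truncation mulOp_apply kerOp_apply)
open B6Prop23Chain (mat mat_kerOp smallness_of_M_large)
open B6Prop23Assembled (K285 theta285 prop23_assembled mat_R_abs_le theta285_le)
open B6Lemma21Repaired (Ineq261With Ineq263With ineq263With_of_261With)
open B6CoverTorus (nC CIdx ctr cd hcov InCube cubeInd cubeInd_zero_or_one cubeInd_eq_one cubeInd_eq_zero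
  cubeInd_mul_hcov inCube_of_hcov_ne_zero sum_hcov_sq card_filter_hcov_ne_zero_le abs_hcov_sub_le gap_of_cubeInd_eq_zero
  abs_hcov_le_one hcov_nonneg)

noncomputable section

variable (P : Params) (a msq : ℝ) (Mb : ℕ)

/-! ## §1  The local inverses `C_□ = ((Q′G′²Q′*)↾□)⁻¹` of (2.70) for the GENUINE `Q′_KG′_K²Q′_K*` (one-scale prescription) -/

/-- The sites of the cube □_k (a finite type). [cite: Balaban1984PropagatorsII, p.235 (2.70); bookkeeping] -/
abbrev Cube (k : CIdx P P.K Mb) : Type := {y : Site P P.K // InCube P P.K Mb k y}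

/-- **`(Q′G′²Q′*)↾□`** — the genuine operator `Q′_KG′_K²Q′_K*` (`B6QGGQInvTowerTorus.qggqK`, G′_K = Δ′_a⁻¹ of the tower) COMPRESSED
to the cube □_k: the print's one-scale prescription *"inverses of the localized operators (Q′G′²Q′*)↾□"*.
[cite: Balaban1984PropagatorsII, p.235 before (2.70)] -/
def Acomp (k : CIdx P P.K Mb) : Matrix (Cube P Mb k) (Cube P Mb k) ℝ :=
  (qggqK P a msq).submatrix Subtype.val Subtype.val

open Classical in
/-- **`C_□ = ((Q′G′²Q′*)↾□)⁻¹`** as a kernel on `T₁^{(K)} × T₁^{(K)}`, extended by zero off □ × □ (C_□ lives on □).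
[cite: Balaban1984PropagatorsII, (2.70) p.235] -/
def Cloc (k : CIdx P P.K Mb) (y y' : Site P P.K) : ℝ :=
  if h : InCube P P.K Mb k y ∧ InCube P P.K Mb k y' then (Acomp P a msq Mb k)⁻¹ ⟨y, h.1⟩ ⟨y', h.2⟩ else 0

variable {P a msq Mb}

/-- `C_□(y, ·) = 0` for `y ∉ □`. [folklore] -/
private theorem Cloc_eq_zero_left {k : CIdx P P.K Mb} {y : Site P P.K} (hy : ¬ InCube P P.K Mb k y) (y' : Site P P.K) :
    Cloc P a msq Mb k y y' = 0 := by
  unfold Cloc; rw [dif_neg (fun h => hy h.1)]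

/-- `C_□(·, y′) = 0` for `y′ ∉ □`. [folklore] -/
private theorem Cloc_eq_zero_right {k : CIdx P P.K Mb} (y : Site P P.K) {y' : Site P P.K} (hy' : ¬ InCube P P.K Mb k y') :
    Cloc P a msq Mb k y y' = 0 := by
  unfold Cloc; rw [dif_neg (fun h => hy' h.2)]

/-- on □ × □, `C_□` is the inverse matrix of the compression. [folklore] -/
private theorem Cloc_eq_inv {k : CIdx P P.K Mb} {y y' : Site P P.K} (hy : InCube P P.K Mb k y) (hy' : InCube P P.K Mb k y') :
    Cloc P a msq Mb k y y' = (Acomp P a msq Mb k)⁻¹ ⟨y, hy⟩ ⟨y', hy'⟩ := by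
  unfold Cloc; rw [dif_pos ⟨hy, hy'⟩]

/-- a sum over `T₁^{(K)}` of a function vanishing off □_k is the sum over the cube. [folklore] -/
private theorem sum_eq_sum_cube (k : CIdx P P.K Mb) (F : Site P P.K → ℝ) (hF : ∀ z, ¬ InCube P P.K Mb k z → F z = 0) :
    ∑ z, F z = ∑ s : Cube P Mb k, F s.val :=
  sum_eq_sum_range (e := (Subtype.val : Cube P Mb k → Site P P.K)) Subtype.val_injective F
    (fun p hp => hF p (fun h => hp ⟨⟨p, h⟩, rfl⟩))

/-- **(2.70) for the genuine compression**: `Σ_{z∈□} (Q′G′²Q′*)(y, z)·C_□(z, y″) = δ_{y,y″}` for `y, y″ ∈ □` — `C_□` IS the inverse of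
`(Q′G′²Q′*)↾□` (the compression of the positive definite `Q′G′²Q′*` is positive definite, hence invertible).
[cite: Balaban1984PropagatorsII, (2.70) p.235] -/
theorem sum_cubeInd_qggqK_Cloc (ha : 0 < a) (hm : 0 ≤ msq) (hK : 1 ≤ P.K) (k : CIdx P P.K Mb) {y : Site P P.K}
    (hy : InCube P P.K Mb k y) (y'' : Site P P.K) :
    ∑ z, cubeInd P P.K Mb k z * (qggqK P a msq y z * Cloc P a msq Mb k z y'') =
      if InCube P P.K Mb k y'' then (if y = y'' then 1 else 0) else 0 := by
  classical
  by_cases hy'' : InCube P P.K Mb k y''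
  · rw [if_pos hy'']
    have hunit : IsUnit (Acomp P a msq Mb k) := by
      have hpos := qggqK_isUnit P ha hm hK
      -- the compression of a coercive symmetric matrix is coercive: via Hyp56 with the trivial kernel bound
      have hco : Coercive (qggqK P a msq) ((1 / Cq P.d a msq) ^ 2) := by
        have h := coercive_qggqK_of_qgqK P ha hm hK (one_div_pos.mpr (Cq_pos P.d ha hm)).le
          (B6QGQCoerciveTowerTorus.coercive_qgq P hK ha hm)
        exact h
      have hγ : 0 < (1 / Cq P.d a msq) ^ 2 := by have := Cq_pos P.d ha hm; positivity
      -- kernel bound with c₀ := max entry, δ₀ := 0 is enough for invertibility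
      set c₀ : ℝ := ∑ p, ∑ q, |qggqK P a msq p q| with hc₀
      have hA : Hyp56 (T1 P P.K) (qggqK P a msq) ((1 / Cq P.d a msq) ^ 2) c₀ 0 := by
        refine hyp56_qggqK P ha hm hK hco fun p q => ?_
        rw [zero_mul, neg_zero, Real.exp_zero, mul_one, hc₀]
        exact (Finset.single_le_sum (f := fun q' => |qggqK P a msq p q'|) (fun _ _ => abs_nonneg _)
          (Finset.mem_univ q)).trans
          (Finset.single_le_sum (f := fun p' => ∑ q', |qggqK P a msq p' q'|)
            (fun _ _ => Finset.sum_nonneg fun _ _ => abs_nonneg _) (Finset.mem_univ p))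
      exact isUnit_of_hyp56 hγ (hyp56_submatrix hA (e := (Subtype.val : Cube P Mb k → Site P P.K)) Subtype.val_injective)
    have hmul : Acomp P a msq Mb k * (Acomp P a msq Mb k)⁻¹ = 1 :=
      Matrix.mul_nonsing_inv _ ((Matrix.isUnit_iff_isUnit_det _).mp hunit)
    have hent := congrFun (congrFun hmul ⟨y, hy⟩) ⟨y'', hy''⟩
    rw [Matrix.mul_apply] at hent
    rw [sum_eq_sum_cube k _ (fun z hz => by rw [cubeInd_eq_zero hz, zero_mul])]
    have e : ∀ s : Cube P Mb k, cubeInd P P.K Mb k s.val * (qggqK P a msq y s.val * Cloc P a msq Mb k s.val y'') =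
        Acomp P a msq Mb k ⟨y, hy⟩ s * (Acomp P a msq Mb k)⁻¹ s ⟨y'', hy''⟩ := by
      intro s
      rw [cubeInd_eq_one s.property, one_mul, Cloc_eq_inv s.property hy'']
      rfl
    rw [Finset.sum_congr rfl fun s _ => e s, hent, Matrix.one_apply]
    by_cases hyy : y = y''
    · subst hyy; simp
    · rw [if_neg hyy, if_neg (fun h => hyy (congrArg Subtype.val h))]
  · rw [if_neg hy'']
    exact Finset.sum_eq_zero fun z _ => by rw [Cloc_eq_zero_right z hy'', mul_zero, mul_zero]


/-! ## §2  The objects of (2.70)/(2.82) as GENUINE matrices on `T₁^{(K)}`; (2.82) and the fixed-point form of (2.86) -/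

variable (P a msq Mb)

/-- □_k as the multiplication operator (a diagonal matrix). [cite: Balaban1984PropagatorsII, (2.82) p.237] -/
def Pmat (k : CIdx P P.K Mb) : Matrix (Site P P.K) (Site P P.K) ℝ := Matrix.diagonal (cubeInd P P.K Mb k)

/-- h_□ as the multiplication operator (a diagonal matrix). [cite: Balaban1984PropagatorsII, (2.70) p.235] -/
def Hmat (k : CIdx P P.K Mb) : Matrix (Site P P.K) (Site P P.K) ℝ := Matrix.diagonal (hcov P P.K Mb k)

/-- C_□ as a matrix on `T₁^{(K)}` (zero off □ × □). [cite: Balaban1984PropagatorsII, (2.70) p.235] -/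
def Cmat (k : CIdx P P.K Mb) : Matrix (Site P P.K) (Site P P.K) ℝ := Matrix.of (Cloc P a msq Mb k)

/-- **`C = Σ_{□∈𝒟} h_□C_□h_□` of (2.70)** for the genuine one-scale operator (`B6Expansion282.Cglued` in the matrix ring of `T₁^{(K)}`).
[cite: Balaban1984PropagatorsII, (2.70) p.235] -/
def Capp : Matrix (Site P P.K) (Site P P.K) ℝ := Cglued (Hmat P Mb) (Cmat P a msq Mb)

/-- **`R` of (2.82)** for the genuine one-scale operator, READ OFF ITS LINES (`B6Expansion282.R282` in the matrix ring) with the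
print's UNMODIFIED one-scale prescription `X̃_□ := X = Q′G′²Q′*` (no change of domain `G′(□̃)`; the third line of (2.82) is then 0):
`R = Σ_□ [h_□, □X□]C_□h_□ + Σ_{□,□′≠□} (□ − 1)h²_{□′}Xh_□C_□h_□`. [cite: Balaban1984PropagatorsII, (2.82) p.237] -/
def Rrw : Matrix (Site P P.K) (Site P P.K) ℝ :=
  R282 (qggqK P a msq) (Pmat P Mb) (fun _ => qggqK P a msq) (Hmat P Mb) (Cmat P a msq Mb)

variable {P a msq Mb}

/-- `□·h_□ = h_□` as matrices. [cite: Balaban1984PropagatorsII, (2.36) p.229; bookkeeping] -/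
theorem Pmat_mul_Hmat (hMb : 1 ≤ Mb) (k : CIdx P P.K Mb) : Pmat P Mb k * Hmat P Mb k = Hmat P Mb k := by
  unfold Pmat Hmat
  rw [Matrix.diagonal_mul_diagonal]
  congr 1
  funext y
  exact cubeInd_mul_hcov hMb k y

/-- **(2.36) as matrices**: `Σ_□ h_□h_□ = 1` (`B6Expansion282.PartitionSq`). [cite: Balaban1984PropagatorsII, (2.36) p.229] -/
theorem partitionSq_Hmat (hMb : 1 ≤ Mb) (hdiv : Mb ∣ P.sitesPerDir P.K) (h2 : 2 * Mb ≤ P.sitesPerDir P.K) :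
    PartitionSq (Hmat P Mb) := by
  unfold PartitionSq Hmat
  ext y y'
  rw [Matrix.sum_apply]
  simp only [Matrix.diagonal_mul_diagonal, Matrix.diagonal_apply, Matrix.one_apply]
  by_cases h : y = y'
  · subst h
    simp only [if_true]
    rw [← sum_hcov_sq hMb hdiv h2 y]
    exact Finset.sum_congr rfl fun k _ => by ring
  · simp [h]

/-- the localized operator `□X□` has entries `□(y)X(y,z)□(z)`. [folklore] -/
private theorem locOp_Pmat_apply (k : CIdx P P.K Mb) (y z : Site P P.K) :
    locOp (Pmat P Mb) (fun _ => qggqK P a msq) k y z = cubeInd P P.K Mb k y * qggqK P a msq y z * cubeInd P P.K Mb k z := by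
  unfold locOp Pmat
  rw [Matrix.mul_diagonal, Matrix.diagonal_mul]

/-- **(2.70) as the operator identity `(□X□)·C_□·h_□ = h_□`** for the genuine compression inverse (the hypothesis `h270` of the cell's
(2.82)-algebra `B6Expansion282.expansion282`). [cite: Balaban1984PropagatorsII, (2.70) p.235] -/
theorem locOp_mul_Cmat_mul_Hmat (ha : 0 < a) (hm : 0 ≤ msq) (hK : 1 ≤ P.K) (hMb : 1 ≤ Mb) (k : CIdx P P.K Mb) :
    locOp (Pmat P Mb) (fun _ => qggqK P a msq) k * Cmat P a msq Mb k * Hmat P Mb k = Hmat P Mb k := by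
  ext y y'
  unfold Hmat
  rw [Matrix.mul_diagonal, Matrix.mul_apply, Matrix.diagonal_apply]
  simp only [locOp_Pmat_apply, Cmat, Matrix.of_apply]
  have e : ∑ z, cubeInd P P.K Mb k y * qggqK P a msq y z * cubeInd P P.K Mb k z * Cloc P a msq Mb k z y' =
      cubeInd P P.K Mb k y * ∑ z, cubeInd P P.K Mb k z * (qggqK P a msq y z * Cloc P a msq Mb k z y') := by
    rw [Finset.mul_sum]
    exact Finset.sum_congr rfl fun z _ => by ring
  rw [e]
  by_cases hy : InCube P P.K Mb k y
  · rw [sum_cubeInd_qggqK_Cloc ha hm hK k hy y', cubeInd_eq_one hy, one_mul]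
    by_cases hy' : InCube P P.K Mb k y'
    · rw [if_pos hy']
      by_cases hyy : y = y'
      · subst hyy; simp
      · rw [if_neg hyy, if_neg hyy, zero_mul]
    · rw [if_neg hy', zero_mul]
      have hne : y ≠ y' := fun h => hy' (h ▸ hy)
      rw [if_neg hne]
  · rw [cubeInd_eq_zero hy, zero_mul, zero_mul]
    by_cases hyy : y = y'
    · subst hyy
      have h0 : hcov P P.K Mb k y = 0 := by
        by_contra hne; exact hy (inCube_of_hcov_ne_zero hMb hne)
      rw [if_pos rfl, h0]
    · rw [if_neg hyy]

/-- **(2.82) FOR THE GENUINE ONE-SCALE OPERATOR**: `Q′G′²Q′*·C = I − R` on `T₁^{(K)}` — EVERY member of the tower-torus family (every volume,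
`K ≥ 1`, `a > 0`, `m² ≥ 0`) and every cube size `M ≥ 1` with `M ∣ N_K`, `2M ≤ N_K`; the cell's verbatim algebra `B6Expansion282.expansion282`
with its three hypotheses (□h_□ = h_□, (2.36), (2.70)) DISCHARGED on the genuine objects. [cite: Balaban1984PropagatorsII, (2.82) p.237] -/
theorem expansion282_towerTorus (ha : 0 < a) (hm : 0 ≤ msq) (hK : 1 ≤ P.K) (hMb : 1 ≤ Mb) (hdiv : Mb ∣ P.sitesPerDir P.K)
    (h2 : 2 * Mb ≤ P.sitesPerDir P.K) : qggqK P a msq * Capp P a msq Mb = 1 - Rrw P a msq Mb :=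
  expansion282 (qggqK P a msq) (Pmat_mul_Hmat hMb) (partitionSq_Hmat hMb hdiv h2) (locOp_mul_Cmat_mul_Hmat ha hm hK hMb)

/-- **(2.86), THE FIXED-POINT FORM, FOR THE GENUINE INVERSE**: `(Q′G′²Q′*)⁻¹ = C + (Q′G′²Q′*)⁻¹R` (i.e. `(Q′G′²Q′*)⁻¹(I − R) = C`, the
content of *"(Q′G′²Q′*)⁻¹ = C(I − R)⁻¹"*) — every member, every admissible cube size; no largeness needed for the identity itself.
[cite: Balaban1984PropagatorsII, (2.86) p.238] -/
theorem inv_eq_Capp_add (ha : 0 < a) (hm : 0 ≤ msq) (hK : 1 ≤ P.K) (hMb : 1 ≤ Mb) (hdiv : Mb ∣ P.sitesPerDir P.K)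
    (h2 : 2 * Mb ≤ P.sitesPerDir P.K) :
    (qggqK P a msq)⁻¹ = Capp P a msq Mb + (qggqK P a msq)⁻¹ * Rrw P a msq Mb :=
  inverse_fixedPoint (cinvK_mul P ha hm hK) (Pmat_mul_Hmat hMb) (partitionSq_Hmat hMb hdiv h2)
    (locOp_mul_Cmat_mul_Hmat ha hm hK hMb)

/-- (2.86) truncated at any order: `(Q′G′²Q′*)⁻¹ = Σ_{n<N} CRⁿ + (Q′G′²Q′*)⁻¹R^N` (`B6Expansion282.neumann_truncation`).
[cite: Balaban1984PropagatorsII, (2.86) p.238] -/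
theorem inv_eq_sum_add (ha : 0 < a) (hm : 0 ≤ msq) (hK : 1 ≤ P.K) (hMb : 1 ≤ Mb) (hdiv : Mb ∣ P.sitesPerDir P.K)
    (h2 : 2 * Mb ≤ P.sitesPerDir P.K) (N : ℕ) :
    (qggqK P a msq)⁻¹ = ∑ n ∈ Finset.range N, Capp P a msq Mb * Rrw P a msq Mb ^ n + (qggqK P a msq)⁻¹ * Rrw P a msq Mb ^ N :=
  neumann_truncation (inv_eq_Capp_add ha hm hK hMb hdiv h2) N

/-! ## §3  (2.81) for the genuine local inverses: `|C_□(y, y′)| ≤ O(1)e^{−δ₁|y−y′|₁}` by [3] Sect. 5, uniformly on the family -/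

/-- **(2.81) FOR THE GENUINE `C_□ = ((Q′G′²Q′*)↾□)⁻¹`, UNIFORMLY ON THE ONE-SCALE TOWER-TORUS FAMILY** (`(L^jη)^{−d−4} = 1` on one scale):
there are `δ₁, O(1) > 0` (functions of `d, L, a, m²`) with `|C_□(y, y′)| ≤ O(1)e^{−δ₁|y−y′|₁}` for every member, every cube size and every
cube — [3] Sect. 5 (5.6) ⇒ (5.7) FOR THE COMPRESSION (`B4Sect5Torus.inv_submatrix_decay`, same constants as for the full operator) fed with
the uniform coercivity `Q′G′²Q′* ≥ 1/C_q²` (`coercive_qgq_family`, `coercive_qggqK_of_qgqK`) and (2.68) (`ineq268_oneScaleTorus`); printed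
*"|C_□(y, y′)| ≤ O(1)(L^jη)^{−d−4}e^{−δ₁(L^jη)^{−1}|y−y′|}, y, y′ ∈ 𝔅∩□. (2.81)"* (off □ × □ the kernel is 0).
[cite: Balaban1984PropagatorsII, (2.81) p.237; Balaban1983RegularityDecay, Thm. Sect. 5 (5.6)–(5.7) p.594] -/
theorem ineq281_towerTorus (d L : ℕ) (hd : 1 ≤ d) (hL : Odd L ∧ 1 < L) {a : ℝ} (ha : 0 < a) {msq : ℝ} (hmsq : 0 ≤ msq) :
    ∃ δC BC : ℝ, 0 < δC ∧ 0 < BC ∧ ∀ (i : Index d L) (Mb : ℕ) (k : CIdx i.P i.P.K Mb) (y y' : Site i.P i.P.K),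
      |Cloc i.P a msq Mb k y y'| ≤ BC * Real.exp (-(δC * T1 i.P i.P.K y y')) := by
  classical
  obtain ⟨δX, CX, hδX, hCX, h268⟩ := ineq268_oneScaleTorus d L hd hL ha hmsq
  set γ₀ : ℝ := (1 / Cq d a msq) ^ 2 with hγ₀
  have hγ : 0 < γ₀ := by have := Cq_pos d ha hmsq; positivity
  have hK0 : ∀ t : ℝ, 0 < t → 0 ≤ (fun t => B6.c0 t 1 ^ d) t := fun t _ => pow_nonneg (B6RandomWalk.c0_nonneg t 1) d
  refine ⟨rate (fun t => B6.c0 t 1 ^ d) γ₀ CX δX, 2 / γ₀, rate_pos hK0 hγ hCX.le hδX, by positivity, ?_⟩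
  intro i Mb k y y'
  by_cases hyy : InCube i.P i.P.K Mb k y ∧ InCube i.P i.P.K Mb k y'
  · have hco : Coercive (qggqK i.P a msq) γ₀ :=
      coercive_qggqK_of_qgqK i.P ha hmsq i.hK (one_div_pos.mpr (Cq_pos d ha hmsq)).le (coercive_qgq_family d L ha hmsq i)
    have hA : Hyp56 (T1 i.P i.P.K) (qggqK i.P a msq) γ₀ CX δX := hyp56_qggqK i.P ha hmsq i.hK hco (h268 i)
    have hS : SumBound (T1 i.P i.P.K) (fun t => B6.c0 t 1 ^ d) := by
      have h := T1_sumBound i.P i.P.K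
      rwa [i.hPd] at h
    have h := inv_submatrix_decay hK0 hγ hCX.le hδX (T1_isPseudoDist i.P i.P.K) hS hA
      (e := (Subtype.val : Cube i.P Mb k → Site i.P i.P.K)) Subtype.val_injective ⟨y, hyy.1⟩ ⟨y', hyy.2⟩
    rw [Cloc_eq_inv hyy.1 hyy.2]
    exact h
  · have h0 : Cloc i.P a msq Mb k y y' = 0 := by unfold Cloc; rw [dif_neg hyy]
    rw [h0, abs_zero]
    positivity


/-! ## §4  Dictionary: the matrices of §2 ARE the census operators of `B6Expansion282`/`B6Prop23Assembled` on `L²(𝔅)` (one scale: weights 1) -/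

section Bridge

variable {S : Type} [Fintype S] [DecidableEq S]

/-- a diagonal matrix acts as the multiplication operator `B6Expansion282.mulOp`. [folklore] -/
private theorem toLin_diagonal (h : S → ℝ) : Matrix.toLinAlgEquiv' (Matrix.diagonal h) = mulOp h := by
  refine LinearMap.ext fun v => funext fun y => ?_
  rw [Matrix.toLinAlgEquiv'_apply, Matrix.mulVec_diagonal, mulOp_apply]

/-- with unit weights, a matrix acts as the kernel operator `B6Expansion282.kerOp` of its entries. [folklore] -/
private theorem toLin_eq_kerOp {w : S → ℝ} (hw : ∀ z, w z = 1) (A : Matrix S S ℝ) :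
    Matrix.toLinAlgEquiv' A = kerOp w (fun y z => A y z) := by
  refine LinearMap.ext fun v => funext fun y => ?_
  rw [Matrix.toLinAlgEquiv'_apply, kerOp_apply]
  simp only [Matrix.mulVec, dotProduct, hw, one_mul]

/-- the census matrix entry `B6Prop23Chain.mat` of the operator of a matrix is the matrix entry. [folklore] -/
private theorem mat_toLin (B : Matrix S S ℝ) (y y' : S) : mat (Matrix.toLinAlgEquiv' B) y y' = B y y' := by
  unfold mat
  rw [Matrix.toLinAlgEquiv'_apply]
  simp [Matrix.mulVec, dotProduct, Pi.single_apply]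

variable {A B D F : Type*} [Ring A] [Ring B] [Fintype D] [FunLike F A B] [RingHomClass F A B] (f : F)

omit [Fintype D] in
/-- ring homomorphisms map `□X̃_□□` to `□X̃_□□`. [folklore] -/
private theorem map_locOp (p t : D → A) (i : D) : f (locOp p t i) = locOp (fun i => f (p i)) (fun i => f (t i)) i := by
  unfold locOp; simp [map_mul]

/-- ring homomorphisms map the glued `C` of (2.70) to the glued `C`. [folklore] -/
private theorem map_Cglued (h c : D → A) : f (Cglued h c) = Cglued (fun i => f (h i)) (fun i => f (c i)) := by
  unfold Cglued; simp [map_sum, map_mul]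

/-- ring homomorphisms map the `R` of (2.82) to the `R` of (2.82). [folklore] -/
private theorem map_R282 [DecidableEq D] (x : A) (p t h c : D → A) :
    f (R282 x p t h c) = R282 (f x) (fun i => f (p i)) (fun i => f (t i)) (fun i => f (h i)) (fun i => f (c i)) := by
  unfold R282 B6Expansion282.comm locOp
  simp [map_sum, map_mul, map_add, map_sub, map_one]

end Bridge

/-! ## §5  The Neumann series in the `ℓ^∞ → ℓ^∞` operator norm (row sums) -/

section Neumann

variable {S : Type} [Fintype S] [DecidableEq S]

attribute [local instance] Matrix.linftyOpNormedRing Matrix.linftyOpNormedAlgebra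

/-- row sums bound the `ℓ^∞`-operator norm. [folklore] -/
private theorem linfty_opNorm_le_of_rows {A : Matrix S S ℝ} {r : ℝ} (hr : 0 ≤ r) (h : ∀ i, ∑ j, |A i j| ≤ r) : ‖A‖ ≤ r := by
  rw [Matrix.linfty_opNorm_def]
  have key : (Finset.univ.sup fun i => ∑ j, ‖A i j‖₊) ≤ r.toNNReal := Finset.sup_le fun i _ => by
    rw [← NNReal.coe_le_coe, NNReal.coe_sum, Real.coe_toNNReal _ hr]
    simpa only [coe_nnnorm, Real.norm_eq_abs] using h i
  calc ((Finset.univ.sup fun i => ∑ j, ‖A i j‖₊ : NNReal) : ℝ) ≤ (r.toNNReal : ℝ) := NNReal.coe_le_coe.mpr key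
    _ = r := Real.coe_toNNReal _ hr

/-- entries are bounded by the `ℓ^∞`-operator norm. [folklore] -/
private theorem abs_entry_le_linfty_opNorm (A : Matrix S S ℝ) (i j : S) : |A i j| ≤ ‖A‖ := by
  rw [Matrix.linfty_opNorm_def]
  have h1 : ‖A i j‖₊ ≤ ∑ j', ‖A i j'‖₊ :=
    Finset.single_le_sum (f := fun j' => ‖A i j'‖₊) (fun _ _ => zero_le) (Finset.mem_univ j)
  have h2 : (∑ j', ‖A i j'‖₊) ≤ Finset.univ.sup fun i => ∑ j', ‖A i j'‖₊ :=
    Finset.le_sup (f := fun i => ∑ j', ‖A i j'‖₊) (Finset.mem_univ i)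
  have := h1.trans h2
  rw [← Real.norm_eq_abs, ← coe_nnnorm]
  exact_mod_cast this

/-- **THE CONVERGENT EXPANSION `G = Σ_{n=0}^∞ CRⁿ`** from the fixed point `G = C + GR` when the row sums of `|R|` are `≤ ½`: the Neumann
series converges (in every entry, i.e. in the topology of the finite-dimensional matrix space) to `G`, with the geometric truncation error
`|(G − Σ_{n<N} CRⁿ)(y, y′)| ≤ B_G·2^{−N}` (`B_G` any bound of the row sums of `|G|`). [cite: Balaban1984PropagatorsII, (2.86) p.238] -/
theorem hasSum_neumann (R C G : Matrix S S ℝ) {BG : ℝ} (hBG : 0 ≤ BG) (hrow : ∀ i, ∑ j, |R i j| ≤ 1 / 2)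
    (hG : ∀ i, ∑ j, |G i j| ≤ BG) (hfix : G = C + G * R) :
    HasSum (fun n => C * R ^ n) G ∧ ∀ N i j, |(G - ∑ n ∈ Finset.range N, C * R ^ n) i j| ≤ BG * (1 / 2) ^ N := by
  have hRle : ‖R‖ ≤ 1 / 2 := linfty_opNorm_le_of_rows (by norm_num) hrow
  have hR : ‖R‖ < 1 := hRle.trans_lt (by norm_num)
  have hs : Summable (fun n => R ^ n) := summable_geometric_of_norm_lt_one hR
  have h3 : (1 - R) * ∑' n, R ^ n = 1 := mul_neg_geom_series R hR
  have h1 : G * (1 - R) = C := by rw [mul_sub, mul_one]; exact (sub_eq_of_eq_add' (by rw [add_comm]; exact hfix))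
  have h2 : G = C * ∑' n, R ^ n := by
    calc G = G * ((1 - R) * ∑' n, R ^ n) := by rw [h3, mul_one]
      _ = C * ∑' n, R ^ n := by rw [← mul_assoc, h1]
  refine ⟨?_, fun N i j => ?_⟩
  · have h4 : HasSum (fun n => C * R ^ n) (C * ∑' n, R ^ n) := hs.hasSum.mul_left C
    rw [h2]; exact h4
  · have e : G - ∑ n ∈ Finset.range N, C * R ^ n = G * R ^ N := by
      nth_rewrite 1 [neumann_truncation hfix N]; abel
    rw [e]
    have hGn : ‖G‖ ≤ BG := linfty_opNorm_le_of_rows hBG hG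
    refine (abs_entry_le_linfty_opNorm _ i j).trans ((norm_mul_le _ _).trans ?_)
    refine mul_le_mul hGn ?_ (norm_nonneg _) hBG
    rcases Nat.eq_zero_or_pos N with hN | hN
    · subst hN
      rw [pow_zero, pow_zero]
      refine linfty_opNorm_le_of_rows zero_le_one fun i' => ?_
      rw [Finset.sum_eq_single i' (fun j' _ hj => by rw [Matrix.one_apply_ne' hj, abs_zero])
        (fun h => (h (Finset.mem_univ _)).elim), Matrix.one_apply_eq, abs_one]
    · exact (norm_pow_le' R hN).trans (pow_le_pow_left₀ (norm_nonneg _) hRle N)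

end Neumann

/-! ## §6  (2.85), (2.86) convergent and (2.87) for the genuine operator: the printed route of Proposition 2.3 run end to end -/

/-- the constant `K` of `B6Prop23Assembled.K285` depends on the geometry only through `L` (the same number for every member of the family).
[cite: Balaban1984PropagatorsII, (2.85) p.238; bookkeeping] -/
def K285L (L : ℝ) (d n₀ : ℕ) (s δ₀ cσ c₃ mg BX BD BC : ℝ) : ℝ :=
  n₀ * (s * BX * (BC * L ^ (d + 4)) * L ^ 4 * cσ / (Real.exp 1 * (1 / 4 * δ₀)) +
      BD * (BC * L ^ (d + 4)) * cσ * L ^ 4 / (Real.exp 1 * c₃)) +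
    n₀ ^ 2 * (BX * (BC * L ^ (d + 4)) * cσ * L ^ 4 / (Real.exp 1 * (1 / 8 * δ₀ * mg)))

/-- on the one-scale torus geometry the census constant `K285` is `K285L` at `L = P.L` (member-independent).
[cite: Balaban1984PropagatorsII, (2.85) p.238; bookkeeping] -/
theorem K285_oneScaleGeo (R : ℕ) (d n₀ : ℕ) (s δ₀ cσ c₃ mg BX BD BC : ℝ) :
    K285 (oneScaleGeo P Mb R) d n₀ s δ₀ cσ c₃ mg BX BD BC = K285L (P.L : ℝ) d n₀ s δ₀ cσ c₃ mg BX BD BC := by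
  unfold K285 B6Prop23Assembled.kappa2 B6Prop23Assembled.kappa3 B6Prop23Assembled.kappa4 K285L
  rfl

/-- `L⁴ ≤ e^{⅛δ₀RM}` as soon as `R ≥ 1` and `M ≥ 32 log L/δ₀` (the threshold of (2.83) member 4 ⇒ 5, void on one scale but kept by the
census lemma). [folklore] -/
private theorem pow_four_le_exp {L δ₀ R M : ℝ} (hL : 1 ≤ L) (hδ₀ : 0 < δ₀) (hR : 1 ≤ R) (hM0 : 0 ≤ M) (hM : 32 * Real.log L / δ₀ ≤ M) :
    L ^ 4 ≤ Real.exp (1 / 8 * δ₀ * R * M) := by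
  have hlog : 0 ≤ Real.log L := Real.log_nonneg hL
  have hRM : M ≤ R * M := le_mul_of_one_le_left hM0 hR
  have h1 : 32 * Real.log L ≤ δ₀ * M := by have := (div_le_iff₀ hδ₀).mp hM; linarith
  have h2 : (4 : ℝ) * Real.log L ≤ 1 / 8 * δ₀ * R * M := by nlinarith [mul_le_mul_of_nonneg_left hRM hδ₀.le]
  have hL0 : 0 < L := lt_of_lt_of_le one_pos hL
  rw [← Real.rpow_natCast, Real.rpow_def_of_pos hL0]
  exact Real.exp_le_exp.mpr (by push_cast; linarith)

/-- **PROPOSITION 2.3's EXPANSION FOR THE GENUINE ONE-SCALE OPERATOR — (2.85), (2.86) CONVERGENT, (2.87).**  For `d ≥ 1`, odd `L > 1`, `a > 0`,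
`m² ≥ 0` there are `M₀, δ₁, K, B > 0` (functions of `d, L, a, m²`) such that for every member of the one-scale tower-torus family
`B6Prop22OneScaleTorus.Index d L` (volume `P`, `K ≥ 1`, big-block size `M = i.Mb`, `R = i.R`) with `R ≥ 1`, `M ≥ M₀`, `M ∣ N_K`, `2M ≤ N_K`
(`N_K = 2L^m` sites per direction of `T₁^{(K)}`), the GENUINE operator `X = Q′_KG′_K²Q′_K*` (`qggqK`), the genuine local inverses
`C_□ = ((Q′G′²Q′*)↾□)⁻¹` (2.70) on the cubes of the torus cover `B6CoverTorus` and the resulting `C`, `R` of (2.70)/(2.82) (`Capp`, `Rrw`) satisfy: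
(2.85) `|R(y, y′)| ≤ (K/M)e^{−δ₁|y−y′|₁}` (*"|R(y, y′)| ≤ O(M⁻¹)e^{−δ₁d(y,y′)}(L^{j′}η)^{−d}"*, `(L^{j′}η)^{−d} = 1`); the row sums of `|R|` are
`≤ ½` (*"so for M large enough the norm is small"*); **(2.86)** *"(Q′G′²Q′*)⁻¹ = C(I − R)⁻¹ = Σ_{n=0}^∞ CRⁿ"*: the series `Σ_n CRⁿ` CONVERGES
to the genuine inverse `(Q′_KG′_K²Q′_K*)⁻¹`, with geometric truncation error `≤ B·2^{−N}`; and (2.87) `|(Q′G′²Q′*)⁻¹(y, y′)| ≤ Be^{−½δ₁|y−y′|₁}`.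
Route = the print's: the per-term estimates and the counting (2.85) are the cell's `B6Prop23Assembled.mat_R_abs_le`/`prop23_assembled`
((2.82)–(2.87) with every O(·) explicit) whose 26 located inputs are ALL DISCHARGED here on the genuine objects — the cover binders by
`B6CoverTorus`, (2.81) by [3] Sect. 5 for the compression (`ineq281_towerTorus`), (2.70) by `sum_cubeInd_qggqK_Cloc`, (2.68) by
`ineq268_oneScaleTorus`, Lemma 2.1 on one scale by `B6Lemma21TowerTorus`; the change-of-domain family of (2.82) is void (one-scale prescription
`X̃_□ = X`, `B_D = 0`). [cite: Balaban1984PropagatorsII, Prop. 2.3 (2.85)–(2.87) p.238, (2.82) p.237, (2.70) p.235] -/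
theorem expansion286_towerTorus (d L : ℕ) (hd : 1 ≤ d) (hL : Odd L ∧ 1 < L) {a : ℝ} (ha : 0 < a) {msq : ℝ} (hmsq : 0 ≤ msq) :
    ∃ M₀ δ₁ K B : ℝ, 0 < M₀ ∧ 0 < δ₁ ∧ 0 < K ∧ 0 < B ∧
      ∀ i : Index d L, 1 ≤ i.R → M₀ ≤ (i.Mb : ℝ) → i.Mb ∣ i.P.sitesPerDir i.P.K → 2 * i.Mb ≤ i.P.sitesPerDir i.P.K →
        (∀ y y', |Rrw i.P a msq i.Mb y y'| ≤ K / i.Mb * Real.exp (-(δ₁ * T1 i.P i.P.K y y'))) ∧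
        (∀ y, ∑ y', |Rrw i.P a msq i.Mb y y'| ≤ 1 / 2) ∧
        HasSum (fun n => Capp i.P a msq i.Mb * Rrw i.P a msq i.Mb ^ n) (qggqK i.P a msq)⁻¹ ∧
        (∀ N y y', |((qggqK i.P a msq)⁻¹ - ∑ n ∈ Finset.range N, Capp i.P a msq i.Mb * Rrw i.P a msq i.Mb ^ n) y y'| ≤
          B * (1 / 2) ^ N) ∧
        (∀ y y', |(qggqK i.P a msq)⁻¹ y y'| ≤ B * Real.exp (-(δ₁ / 2 * T1 i.P i.P.K y y'))) := by
  classical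
  -- the uniform analytic inputs: (2.68) and (2.81)
  obtain ⟨δX, CX, hδX, hCX, h268⟩ := ineq268_oneScaleTorus d L hd hL ha hmsq
  obtain ⟨δC, BC, hδC, hBC, h281⟩ := ineq281_towerTorus d L hd hL ha hmsq
  -- the constants of the census assembly
  set δ₀ : ℝ := 2 * δX with hδ₀def
  have hδ₀ : 0 < δ₀ := by positivity
  set δ₁ : ℝ := min δC (δ₀ / 8) with hδ₁def
  have hδ₁ : 0 < δ₁ := lt_min hδC (by positivity)
  have hδ₁C : δ₁ ≤ δC := min_le_left _ _
  set σ : ℝ := 1 / 8 with hσ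
  set cσ : ℝ := B6.c0 δ₀ σ ^ d with hcσ
  set c : ℝ := B6.c0 δ₁ (1 / 2) ^ d with hcdef
  have hc : 0 ≤ c := pow_nonneg (B6RandomWalk.c0_nonneg _ _) d
  set c' : ℝ := B6.c0 δ₁ 1 ^ d with hc'def
  have hc' : 0 ≤ c' := pow_nonneg (B6RandomWalk.c0_nonneg _ _) d
  set s : ℝ := 3 * Real.pi / 2 with hsdef
  have hs : 0 ≤ s := by positivity
  set n₀ : ℕ := 2 ^ d with hn₀
  set K : ℝ := K285L (L : ℝ) d n₀ s δ₀ cσ 1 (1 / 3) CX 0 BC with hKdef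
  set Bk : ℝ := 2 * (n₀ * (BC * (L : ℝ) ^ (d + 4))) * c with hBkdef
  set M₀ : ℝ := max 1 (max (32 * Real.log L / δ₀) (max (2 * K * c) (2 * (K + 1) * c'))) with hM₀def
  have hL1 : (1 : ℝ) ≤ L := by exact_mod_cast hL.2.le
  have hcσ0 : 0 ≤ cσ := pow_nonneg (B6RandomWalk.c0_nonneg _ _) d
  have hKnn : 0 ≤ K := by
    rw [hKdef]; unfold K285L; positivity
  have hBk : 0 ≤ Bk := by rw [hBkdef]; positivity
  refine ⟨M₀, δ₁, K + 1, Bk * c + Bk + 1, lt_of_lt_of_le one_pos (le_max_left _ _), hδ₁, by linarith, by positivity, ?_⟩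
  intro i hR hM hdiv h2
  -- the member's data
  have hMb1 : (1 : ℝ) ≤ i.Mb := le_trans (le_max_left _ _) hM
  have hMb : 1 ≤ i.Mb := by exact_mod_cast hMb1
  have hMpos : (0 : ℝ) < i.Mb := by positivity
  set g := oneScaleGeo i.P i.Mb i.R with hgdef
  have htri := triangle254_oneScaleGeo i.P i.Mb i.R
  have hrefl : ∀ y : g.Site, g.dist y y = 0 := T1_self i.P i.P.K
  have hdnn : ∀ y y' : g.Site, 0 ≤ g.dist y y' := T1_nonneg i.P i.P.K
  have hsep : B6Ineq268.LevelSep g := by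
    intro y y'
    show (i.R : ℝ) * (i.Mb : ℝ) * B6Ineq268.mx g y y' ≤ T1 i.P i.P.K y y'
    have hmx : B6Ineq268.mx g y y' = 0 := by
      unfold B6Ineq268.mx
      show max (|((i.P.K : ℕ) : ℝ) - ((i.P.K : ℕ) : ℝ)| - 1) 0 = 0
      rw [sub_self, abs_zero, zero_sub]; exact max_eq_right (by norm_num)
    rw [hmx, mul_zero]; exact T1_nonneg i.P i.P.K y y'
  have hgL : 1 ≤ g.L := by show (1 : ℝ) ≤ (i.P.L : ℝ); exact_mod_cast i.P.hL.2.le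
  have hgη : 0 < g.eta := i.P.eps_pos
  have hgM : 0 < g.M := by show (0 : ℝ) < (i.Mb : ℝ); exact hMpos
  have hRM : 0 ≤ g.R * g.M := by show (0 : ℝ) ≤ (i.R : ℝ) * (i.Mb : ℝ); positivity
  have hsplit : δ₁ + σ * δ₀ ≤ δ₀ / 4 := by
    have := min_le_right δC (δ₀ / 8); rw [hσ]; linarith
  have h261σ : Ineq261With cσ g δ₀ σ := by
    intro y
    have h := sum_exp_T1_le i.P i.P.K (show 0 < σ * δ₀ by positivity) y
    rw [i.hPd] at h
    exact h
  have hR1 : (1 : ℝ) ≤ i.R := by exact_mod_cast hR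
  have hthr : g.L ^ 4 ≤ Real.exp (1 / 8 * δ₀ * g.R * g.M) := by
    show ((i.P.L : ℕ) : ℝ) ^ 4 ≤ Real.exp (1 / 8 * δ₀ * (i.R : ℝ) * (i.Mb : ℝ))
    rw [i.hPL]
    exact pow_four_le_exp hL1 hδ₀ hR1 hMpos.le (le_trans (le_trans (le_max_left _ _) (le_max_right _ _)) hM)
  have h261 : Ineq261With c g δ₁ (1 / 2) := by
    intro y
    have h := sum_exp_T1_le i.P i.P.K (show 0 < 1 / 2 * δ₁ by positivity) y
    rw [i.hPd] at h
    exact h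
  have h263 : Ineq263With c g δ₁ (1 / 2) := ineq263With_of_261With htri hδ₁.le (by norm_num) h261
  -- the cover
  have hover : ∀ y : g.Site, (Finset.univ.filter fun k : CIdx i.P i.P.K i.Mb => hcov i.P i.P.K i.Mb k y ≠ 0).card ≤ n₀ := by
    intro y
    have h := card_filter_hcov_ne_zero_le hMb hdiv h2 y
    exact h.trans (le_of_eq (by rw [i.hPd]))
  have hpf01 : ∀ (k : CIdx i.P i.P.K i.Mb) (y : g.Site), cubeInd i.P i.P.K i.Mb k y = 0 ∨ cubeInd i.P i.P.K i.Mb k y = 1 :=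
    fun k y => cubeInd_zero_or_one k y
  have hph : ∀ (k : CIdx i.P i.P.K i.Mb) (y : g.Site), cubeInd i.P i.P.K i.Mb k y * hcov i.P i.P.K i.Mb k y = hcov i.P i.P.K i.Mb k y :=
    fun k y => cubeInd_mul_hcov hMb k y
  have hh1 : ∀ (k : CIdx i.P i.P.K i.Mb) (y : g.Site), |hcov i.P i.P.K i.Mb k y| ≤ 1 := fun k y => abs_hcov_le_one k y
  have h236 : ∀ y : g.Site, ∑ k : CIdx i.P i.P.K i.Mb, hcov i.P i.P.K i.Mb k y ^ 2 = 1 := fun y => sum_hcov_sq hMb hdiv h2 y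
  have hLip : ∀ (k : CIdx i.P i.P.K i.Mb) (y y'' : g.Site),
      |hcov i.P i.P.K i.Mb k y - hcov i.P i.P.K i.Mb k y''| ≤ s / g.M * g.dist y y'' :=
    fun k y y'' => abs_hcov_sub_le hMb k y y''
  have hcube : ∀ (k : CIdx i.P i.P.K i.Mb) (y : g.Site), cubeInd i.P i.P.K i.Mb k y ≠ 0 →
      (fun _ : CIdx i.P i.P.K i.Mb => i.P.K) k ≤ g.scale y ∧ g.scale y ≤ (fun _ : CIdx i.P i.P.K i.Mb => i.P.K) k + 1 :=
    fun k y _ => ⟨le_rfl, Nat.le_succ _⟩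
  have hlev : ∀ (k : CIdx i.P i.P.K i.Mb) (y y' : g.Site), hcov i.P i.P.K i.Mb k y ≠ 0 → hcov i.P i.P.K i.Mb k y' ≠ 0 →
      g.scale y = g.scale y' := fun _ _ _ _ _ => rfl
  have hgap : ∀ (k : CIdx i.P i.P.K i.Mb) (y y'' : g.Site), cubeInd i.P i.P.K i.Mb k y = 0 → hcov i.P i.P.K i.Mb k y'' ≠ 0 →
      1 / 3 * g.M ≤ g.dist y y'' := by
    intro k y y'' hy hy''
    have h := gap_of_cubeInd_eq_zero hMb hy hy''
    show 1 / 3 * (i.Mb : ℝ) ≤ T1 i.P i.P.K y y''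
    linarith
  -- the kernels: X = X̃_□ = entries of Q′G′²Q′*, C_□ = Cloc
  have hlen : ∀ z : g.Site, g.len z = 1 := fun z => oneScaleGeo_len i.P i.Mb i.R z
  have hw : ∀ z : g.Site, g.len z ^ d = 1 := fun z => by rw [hlen, one_pow]
  have hX : ∀ y y'' : g.Site, |g.len y'' ^ d * qggqK i.P a msq y y''| ≤
      CX * g.len y ^ 4 * Real.exp (-(1 / 2 * δ₀ * g.dist y y'')) := by
    intro y y''
    rw [hw y'', hlen y, one_mul, one_pow, mul_one, show 1 / 2 * δ₀ = δX by rw [hδ₀def]; ring]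
    exact h268 i y y''
  have hdom : ∀ (k : CIdx i.P i.P.K i.Mb) (y y'' : g.Site),
      |cubeInd i.P i.P.K i.Mb k y * (g.len y'' ^ d * (qggqK i.P a msq y y'' - qggqK i.P a msq y y'')) * hcov i.P i.P.K i.Mb k y''| ≤
        0 * Real.exp (-(1 * g.M)) * g.len y ^ 4 * Real.exp (-(1 / 2 * δ₀ * g.dist y y'')) := by
    intro k y y''; simp
  have hspK : g.L ^ i.P.K * g.eta = 1 := i.P.spacing_K
  have h281' : ∀ (k : CIdx i.P i.P.K i.Mb) (y y' : g.Site), cubeInd i.P i.P.K i.Mb k y ≠ 0 → cubeInd i.P i.P.K i.Mb k y' ≠ 0 →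
      |Cloc i.P a msq i.Mb k y y'| ≤ BC / (g.L ^ ((fun _ : CIdx i.P i.P.K i.Mb => i.P.K) k) * g.eta) ^ (d + 4) *
        Real.exp (-(δ₁ * g.dist y y')) := by
    intro k y y' _ _
    simp only [hspK, one_pow, div_one]
    refine (h281 i i.Mb k y y').trans (mul_le_mul_of_nonneg_left ?_ hBC.le)
    exact Real.exp_le_exp.mpr (neg_le_neg (mul_le_mul_of_nonneg_right hδ₁C (T1_nonneg i.P i.P.K y y')))
  have hCk0 : ∀ (k : CIdx i.P i.P.K i.Mb) (y'' y' : g.Site), cubeInd i.P i.P.K i.Mb k y'' = 0 → Cloc i.P a msq i.Mb k y'' y' = 0 := by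
    intro k y'' y' h
    exact Cloc_eq_zero_left (fun hin => by rw [cubeInd_eq_one hin] at h; exact one_ne_zero h) y'
  -- the dictionary operators ↔ matrices
  set f : Matrix (Site i.P i.P.K) (Site i.P i.P.K) ℝ ≃ₐ[ℝ] Module.End ℝ (Site i.P i.P.K → ℝ) := Matrix.toLinAlgEquiv' with hfdef
  have fX : kerOp (fun z => g.len z ^ d) (fun y y'' => qggqK i.P a msq y y'') = f (qggqK i.P a msq) :=
    (toLin_eq_kerOp hw _).symm
  have fP : ∀ k, mulOp (cubeInd i.P i.P.K i.Mb k) = f (Pmat i.P i.Mb k) := fun k => (toLin_diagonal _).symm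
  have fH : ∀ k, mulOp (hcov i.P i.P.K i.Mb k) = f (Hmat i.P i.Mb k) := fun k => (toLin_diagonal _).symm
  have fC : ∀ k, kerOp (fun z => g.len z ^ d) (Cloc i.P a msq i.Mb k) = f (Cmat i.P a msq i.Mb k) := fun k => by
    rw [Cmat, toLin_eq_kerOp hw]; rfl
  have eP : (fun k => mulOp (cubeInd i.P i.P.K i.Mb k)) = fun k => f (Pmat i.P i.Mb k) := funext fP
  have eH : (fun k => mulOp (hcov i.P i.P.K i.Mb k)) = fun k => f (Hmat i.P i.Mb k) := funext fH
  have eC : (fun k => kerOp (fun z => g.len z ^ d) (Cloc i.P a msq i.Mb k)) = fun k => f (Cmat i.P a msq i.Mb k) := funext fC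
  have eX : (fun _ : CIdx i.P i.P.K i.Mb => kerOp (fun z => g.len z ^ d) fun y y'' => qggqK i.P a msq y y'') =
      fun _ => f (qggqK i.P a msq) := funext fun _ => fX
  have h270 : ∀ k : CIdx i.P i.P.K i.Mb,
      locOp (fun k => mulOp (cubeInd i.P i.P.K i.Mb k)) (fun _ => kerOp (fun z => g.len z ^ d) fun y y'' => qggqK i.P a msq y y'') k *
          kerOp (fun z => g.len z ^ d) (Cloc i.P a msq i.Mb k) * mulOp (hcov i.P i.P.K i.Mb k) =
        mulOp (hcov i.P i.P.K i.Mb k) := by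
    intro k
    rw [eP, eX, fC k, fH k, ← map_locOp f, ← map_mul, ← map_mul, locOp_mul_Cmat_mul_Hmat ha hmsq i.hK hMb k]
  have hRop : R282 (kerOp (fun z => g.len z ^ d) fun y y'' => qggqK i.P a msq y y'') (fun k => mulOp (cubeInd i.P i.P.K i.Mb k))
      (fun _ => kerOp (fun z => g.len z ^ d) fun y y'' => qggqK i.P a msq y y'') (fun k => mulOp (hcov i.P i.P.K i.Mb k))
      (fun k => kerOp (fun z => g.len z ^ d) (Cloc i.P a msq i.Mb k)) = f (Rrw i.P a msq i.Mb) := by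
    rw [eP, eX, eH, eC, fX, Rrw, map_R282 f]
  have hCop : Cglued (fun k => mulOp (hcov i.P i.P.K i.Mb k)) (fun k => kerOp (fun z => g.len z ^ d) (Cloc i.P a msq i.Mb k)) =
      f (Capp i.P a msq i.Mb) := by
    rw [eH, eC, Capp, map_Cglued f]
  -- (2.85) for the genuine R
  have hK285 : K285 g d n₀ s δ₀ cσ 1 (1 / 3) CX 0 BC = K := by
    rw [hKdef, hgdef, K285_oneScaleGeo, i.hPL]
  have h285 : ∀ y y', |Rrw i.P a msq i.Mb y y'| ≤ K / i.Mb * Real.exp (-(δ₁ * T1 i.P i.P.K y y')) := by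
    intro y y'
    have h := mat_R_abs_le htri hdnn hsep hgL hgη hgM hRM hδ₀ hδ₁.le hsplit h261σ hthr hs hCX.le le_rfl hBC.le d
      hover hpf01 hph hh1 hLip hcube hlev hgap hX (fun _ => hX) hdom h281' hCk0 y y'
    have e : mat (f (Rrw i.P a msq i.Mb)) y y' = Rrw i.P a msq i.Mb y y' := by rw [hfdef, mat_toLin]
    rw [← e, ← hRop]
    refine h.trans (mul_le_mul_of_nonneg_right ?_ (Real.exp_pos _).le)
    have hθ := theta285_le hgM (d := d) (n₀ := n₀) (s := s) hδ₀ one_pos (by norm_num : (0 : ℝ) < 1 / 3) hcσ0 hCX.le le_rfl hBC.le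
      (le_trans zero_le_one hgL)
    rw [hK285] at hθ
    exact hθ
  have h285' : ∀ y y', |Rrw i.P a msq i.Mb y y'| ≤ (K + 1) / i.Mb * Real.exp (-(δ₁ * T1 i.P i.P.K y y')) := fun y y' =>
    (h285 y y').trans (mul_le_mul_of_nonneg_right (div_le_div_of_nonneg_right (by linarith) hMpos.le) (Real.exp_pos _).le)
  -- the row sums of |R| are ≤ ½ (M ≥ 2(K+1)c′)
  have hrow : ∀ y, ∑ y', |Rrw i.P a msq i.Mb y y'| ≤ 1 / 2 := by
    intro y
    have hsum : ∑ y', Real.exp (-(δ₁ * T1 i.P i.P.K y y')) ≤ c' := by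
      have h := sum_exp_T1_le i.P i.P.K (show 0 < 1 * δ₁ by simpa using hδ₁) y
      rw [i.hPd] at h
      simpa only [one_mul] using h
    have hM' : 2 * (K + 1) * c' ≤ i.Mb := le_trans (le_trans (le_trans (le_max_right _ _) (le_max_right _ _)) (le_max_right _ _)) hM
    calc ∑ y', |Rrw i.P a msq i.Mb y y'| ≤ ∑ y', (K + 1) / i.Mb * Real.exp (-(δ₁ * T1 i.P i.P.K y y')) :=
          Finset.sum_le_sum fun y' _ => h285' y y'
      _ = (K + 1) / i.Mb * ∑ y', Real.exp (-(δ₁ * T1 i.P i.P.K y y')) := by rw [Finset.mul_sum]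
      _ ≤ (K + 1) / i.Mb * c' := mul_le_mul_of_nonneg_left hsum (by positivity)
      _ ≤ 1 / 2 := by
          rw [div_mul_eq_mul_div, div_le_iff₀ hMpos]; linarith
  -- Proposition 2.3 assembled: the inverse and (2.87)
  have hKM : 2 * K285 g d n₀ s δ₀ cσ 1 (1 / 3) CX 0 BC * c ≤ g.M := by
    rw [hK285]
    show 2 * K * c ≤ (i.Mb : ℝ)
    exact le_trans (le_trans (le_trans (le_max_left _ _) (le_max_right _ _)) (le_max_right _ _)) hM
  obtain ⟨G, hGX, -, -, huniq, hb⟩ := prop23_assembled d htri hrefl hdnn hsep hgL hgη hgM hRM hδ₀ hδ₁.le hsplit h261σ hthr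
    h261 h263 hc one_pos hs (by norm_num : (0 : ℝ) < 1 / 3) hCX.le le_rfl hBC.le hover hpf01 hph h236 hLip hcube hlev hgap hX
    (fun _ => hX) hdom h281' hCk0 h270 hKM
  have hGeq : G = f ((qggqK i.P a msq)⁻¹) := by
    refine (huniq (f ((qggqK i.P a msq)⁻¹)) ?_).symm
    rw [fX, ← map_mul, cinvK_mul i.P ha hmsq i.hK, map_one]
  have h287 : ∀ y y', |(qggqK i.P a msq)⁻¹ y y'| ≤ Bk * Real.exp (-(δ₁ / 2 * T1 i.P i.P.K y y')) := by
    intro y y'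
    have h := hb y y'
    rw [hGeq, hfdef, mat_toLin, hw y', hlen y, hlen y', div_one, Real.one_rpow, Real.one_rpow, mul_one, mul_one] at h
    refine h.trans (le_of_eq ?_)
    show 2 * (n₀ * (BC * g.L ^ (d + 4))) * c * Real.exp (-(δ₁ / 2 * T1 i.P i.P.K y y')) = Bk * Real.exp (-(δ₁ / 2 * T1 i.P i.P.K y y'))
    rw [hBkdef, show g.L = ((i.P.L : ℕ) : ℝ) from rfl, i.hPL]
  -- the Neumann series (2.86)
  have hGrow : ∀ y, ∑ y', |(qggqK i.P a msq)⁻¹ y y'| ≤ Bk * c := by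
    intro y
    have hsum : ∑ y', Real.exp (-(δ₁ / 2 * T1 i.P i.P.K y y')) ≤ c := by
      have h := h261 y
      refine le_trans (le_of_eq (Finset.sum_congr rfl fun y' _ => ?_)) h
      show Real.exp (-(δ₁ / 2 * T1 i.P i.P.K y y')) = Real.exp (-(1 / 2 * δ₁ * T1 i.P i.P.K y y'))
      ring_nf
    calc ∑ y', |(qggqK i.P a msq)⁻¹ y y'| ≤ ∑ y', Bk * Real.exp (-(δ₁ / 2 * T1 i.P i.P.K y y')) :=
          Finset.sum_le_sum fun y' _ => h287 y y'
      _ = Bk * ∑ y', Real.exp (-(δ₁ / 2 * T1 i.P i.P.K y y')) := by rw [Finset.mul_sum]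
      _ ≤ Bk * c := mul_le_mul_of_nonneg_left hsum hBk
  obtain ⟨hsum286, htrunc⟩ := hasSum_neumann (Rrw i.P a msq i.Mb) (Capp i.P a msq i.Mb) ((qggqK i.P a msq)⁻¹)
    (mul_nonneg hBk hc) hrow hGrow (inv_eq_Capp_add ha hmsq i.hK hMb hdiv h2)
  refine ⟨h285', hrow, hsum286, fun N y y' => (htrunc N y y').trans ?_, fun y y' => (h287 y y').trans ?_⟩
  · exact mul_le_mul_of_nonneg_right (by linarith) (by positivity)
  · exact mul_le_mul_of_nonneg_right (by nlinarith) (Real.exp_pos _).le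

/-- **(2.86) entrywise**: for the members of `expansion286_towerTorus`, every matrix entry of the genuine inverse is the sum of the series
`Σ_n (CRⁿ)(y, y′)`. [cite: Balaban1984PropagatorsII, (2.86) p.238] -/
theorem hasSum_entry_of_hasSum {P : Params} {C R G : Matrix (Site P P.K) (Site P P.K) ℝ} (h : HasSum (fun n => C * R ^ n) G)
    (y y' : Site P P.K) : HasSum (fun n => (C * R ^ n) y y') (G y y') :=
  h.map (Matrix.entryLinearMap ℝ ℝ y y') (continuous_id.matrix_elem y y')

/-- **Non-vacuity of the member conditions**: for every `M₀` and every `K ≥ 1` the family has members with `R = 1`, `M = L^{m′} ≥ M₀`,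
`M ∣ N_K = 2L^m`, `2M ≤ N_K` (take `m = m′ + 1`). [cite: Balaban1984PropagatorsII, (2.1)–(2.2) p.224; bookkeeping] -/
theorem members_exist (d L : ℕ) (hd : 1 ≤ d) (hL : Odd L ∧ 1 < L) (K : ℕ) (hK : 1 ≤ K) (M₀ : ℝ) :
    ∃ i : Index d L, i.P.K = K ∧ 1 ≤ i.R ∧ M₀ ≤ (i.Mb : ℝ) ∧ i.Mb ∣ i.P.sitesPerDir i.P.K ∧ 2 * i.Mb ≤ i.P.sitesPerDir i.P.K := by
  obtain ⟨m', hm'⟩ : ∃ m' : ℕ, M₀ ≤ ((L ^ m' : ℕ) : ℝ) := by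
    obtain ⟨n, hn⟩ := exists_nat_ge M₀
    refine ⟨n, hn.trans ?_⟩
    exact_mod_cast (Nat.lt_pow_self hL.2 (n := n)).le
  let P : Params := ⟨d, L, m' + 1, K, hd, hL⟩
  have hcov := B6CoverTorus.cover_hyps_pow (P := P) (j := K) (m' := m') (by show m' + 1 ≤ m' + 1 + K - K; omega)
  exact ⟨⟨⟨P, rfl, rfl, hK⟩, L ^ m', 1⟩, rfl, le_rfl, hm', hcov.2.1, hcov.2.2⟩

end

end Literature.MathematicalPhysics.QuantumFieldTheory.Balaban1983to89.B6Expansion286TowerTorus
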